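import Summits.QuantumFields.YangMills.Theorems.BalabanUVNodesN12MinimiserFamilyOfClassThresholdUniform
import Summits.QuantumFields.YangMills.Theorems.BalabanUVNodesN12GaugeLetterLocExplicit

/-!
# DAG node N12 [B15] — εreg-UNIFORM EDITION OF THE (J0′) PRODUCER WITH DATUM LETTERS (the honest shape of `…N12MinimiserFamilyOfClassDatumLetters`): the threshold `δ₀` is announced
# BEFORE the class tolerance `εr`, the class facts and the datum tolerance `ρn`; the (σ)_N tolerance inequality `T(ρn, εr) ≤ δ₀` comes AFTER all three — so the consumer chooses
# `εr, ρn` small against an already-announced `δ₀`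

[Balaban1989LargeFieldII] = «[LF-II]», p. 357, (1.12)–(1.13) p. 359; [Balaban1989LargeFieldI] = «[IV]», (1.74) p. 192, Prop. 1 p. 194; [Balaban1985Variational] = «[15]», (2)–(4) p. 278, Thm 1
p. 279, (16)–(18) p. 280, Sect. C (44)–(48) p. 285, (181) p. 307; [Balaban1985RegularSpaces] (1.7) p. 77, (1.19) p. 79; [Balaban1985Averaging] = «[4]», Prop. 2 (52)–(53) p. 26, (122)–(126)
p. 36; [Balaban1988Convergent] = «[III]», (1.3) p. 246, (2.2) p. 255, (2.10)–(2.13) pp. 256–257, (2.16) p. 257.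

Cell `pub-ymgap`, HUMAN RULINGS D-0062 ∕ D-0149, lane owner `pub-ymgap-dag-n12-c` (g26, strategy s1).  Key K1⁹ `stmt-QuantumFields-27364`, `--kind proof --supports … --as helper`; count-neutral.
NEW leaf; CONSUMED BY NAME, nothing modified: `…N12MinimiserFamilyOfClassThresholdUniform` §3 (the residual-gauge form with `δ₀` first) and dag-n12-w3 g4's (σ)_N letter of record
`N12GaugeLetterLocExplicit.exists_gaugeLetterLoc_atRecord_explicit` (stated for EVERY `ν`, here at `ν⟨εreg := εr⟩`).

WHY — THE LANE's A2 SELF-REPORT (pub-ymgap INBOX 2026-08-29T14:02Z, «LOCATED-SHAPE-V5»).  `…N12MinimiserFamilyOfClassDatumLetters` (p723781) states `… (ν) … {ρn} : ∃ δ₀ > 0 ∧ (T(ρn, ν.εreg) ≤ δ₀ → …)`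
with `T ≥ C₁·ν.εreg·η₀² > 0` fixed BEFORE `δ₀` — junk-closable by shape (`δ₀ := T∕2`), although its proof is honest.  THIS FILE is the honest shape: `δ₀` first (from
`…_threshold_residual_uniform`, whose `δ₀` is built from `εreg`-free data), then `∀ εr > 0` ([4]-Prop.-2-small, below the floors `12(d−1)L·εr ≤ ρ″`, `εr ≤ εH`), the class facts at
`ν⟨εreg := εr⟩`, then `∀ ρn ≥ 0`, then `T(ρn, εr) ≤ δ₀` — satisfiable by taking `εr, ρn` small (`T → 0`) — then per base field ONLY (E) · datum regularity · the datum letter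
`∀ c ∈ 𝒞, dist1 ((ext V_k) c) ≤ ρn` · (T1@q₀).

CONTENTS (namespace `Summit.QuantumFields.YangMills.BalabanUVNodes.N12MinimiserFamilyOfClassDatumLettersUniform`; one theorem, no `def`, no `instance`, no `sorry`).
★★★ `hMin_atRecord_of_node00Letters_thm1AtBase_central_ofClass_datumLetters_uniform`.

HONEST FRAMING ∕ LOCATED.  Composition by name + binder order; (E) and (T1@q₀) remain [15] Thm 1's rows; the datum letter carries the LOCATED-GEOM v3 scope (ring-like `Ω₁(Z)` with large datum
holonomy: unsatisfiable on `𝒞 ⊇` shadows — displayed); `δ₀` EXISTENTIAL per (instance, height) but CERTIFIED independent of the class and datum tolerances (still U4: NOT print's volume-uniform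
constant; k-uniformity NOT claimed); nothing of Bałaban's estimates asserted; count-neutral helper; N12 NOT discharged; K1⁹ NOT closed; counts unmoved; one finite 𝕋⁴ programme at fixed ε —
R4 closes the conditional finite-𝕋⁴ rung `BalabanLadder.UV` only; NOT continuum ∕ OS ∕ mass gap ∕ Clay.
-/

noncomputable section

open scoped BigOperators Matrix.Norms.L2Operator Topology

namespace Summit.QuantumFields.YangMills.BalabanUVNodes.N12MinimiserFamilyOfClassDatumLettersUniform

open Set Metric Filter
open Literature.MathematicalPhysics.QuantumFieldTheory.Balaban1983to89
open Literature.MathematicalPhysics.QuantumFieldTheory.Balaban1983to89.Node00 (SU coeField coeField_apply SmallBelow ConstrSet constrCard constrEnum dIterL)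
open T4Continuum B15DeterminingSets GaugeField
open B14.Eq213MaximalDomains (side)
open B14.Eq213DetSet (Bj Bj_of_gt Bj_zero maxDomT)
open B15Prop1Carrier (plaqsInside)
open B15AveragingHolomorphic (iterMh)
open B15ComplexifiedDatumFamily (conjVec)
open B15SU2ChartHolomorphic (genE expMulC logCoordC)
open B15Prop1AnalyticExtClause (cplxVec norm_cplxVec_apply)
open B15Prop1ChartCalculusSU2 (E3)
open B15Prop1ChartSU2 (su2Chart)
open B15ShellGauge193 (shellGauge)
open B15Extension193 (extend)
open B16Sect1Backgrounds (toMS expMul)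
open ExpMeanLog (expMeanLogSU)
open BlockAveraging (blockAvg)
open T4CubeChartGnomonic (SU2)
open Literature.MathematicalPhysics.QuantumFieldTheory.BalabanImbrieJaffe1984to88.BIJ85Eq453GaugeField (qsstarGIter0)
open Summit.QuantumFields.YangMills.BalabanUVNodes.N12MinimiserFamilyOfClassGaugeRow (hMin_atRecord_of_node00Letters_thm1AtBase_central_ofClass_gaugeRow)
open Summit.QuantumFields.YangMills.BalabanUVNodes.N12MultiplierLetterOfClass (multiplierLetter_Bj_of_isMinimizer_class_of_curvatureLetter)
open Summit.QuantumFields.YangMills.BalabanUVNodes.N12HVelocityOfClass (hH_velocity_Bj_of_isMinimizer_class)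
open B15Prop1MinimiserTowerAxialGauge (isMinimizer_gaugeAct_of_residual)
open B15Eq177ValueInvarianceCoDiv (gaugeAct_mem_regMSCoPOfRecord)
open B16Sect1Backgrounds (mulG gaugeAct_gaugeAct)
open B14Eq16FaddeevPopov (wilsonAction4_gaugeAct')
open Summit.QuantumFields.YangMills.BalabanUVNodes.N12SliceDatumCurvatureOfClass (exists_uniform_sliceDatum_curvatureLetter_of_class)
open B5Eq118OneStroke (iterBlockOf)
open B14.Eq216Concrete (feeds)
open B15Eq112TorusCover (lift)
open T4AxialGaugeSmallField (boxPlaqs)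
open T4AdjointCovarianceUnitary (lieSU)
open Node00 (msChart avOfRecord regMSCoPOfRecord)
open scoped Matrix.Norms.L2Operator

open Summit.QuantumFields.YangMills.BalabanUVNodes.N12MinimiserFamilyOfClassThresholdUniform (hMin_atRecord_of_node00Letters_thm1AtBase_central_ofClass_threshold_residual_uniform)
open Summit.QuantumFields.YangMills.BalabanUVNodes.N12GaugeLetterLocExplicit (exists_gaugeLetterLoc_atRecord_explicit)
open ExpMeanLog (deltaSU)
open B14.Eq22Determines (blockIter)
variable {F : T4Family} {k : ℕ}

/-- ★★★ **V5u — THE (J0′) PRODUCER WITH DATUM LETTERS, THRESHOLD FIRST.**  Instance-level: the capstone's record data + one forest + dag-n12-w3's (σ)_N level guard, radii ∕ support lower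
bounds on `M₁` and region geometry (`𝒞`, `N`, `hGN`, `hN1`, `hGmem`); per height the radius letter at `ρ″ > 0`, `6(d−1)Lᵏ·δ ≤ ρ″`, dag-n12-w6's `hHB` at `(εH, B)`.  ANNOUNCED `∃ δ₀ > 0`.
THEN for every class tolerance `εr > 0` with `12(d−1)L·εr ≤ ρ″`, `εr ≤ εH` and [4]-Prop.-2 smallness, every closed `reg' ⊇ closure U_k({Ω_j(Z)}, εr)` with continuous constrained averages,
every datum tolerance `ρn ≥ 0` with `T(ρn, εr) ≤ δ₀`, and per base field (E) · `PlaqSmallOn (plaqsInside (pts k Z)) δ (ext V_k)` · `∀ c ∈ 𝒞, dist1 ((ext V_k) c) ≤ ρn` · (T1@q₀): the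
(J0′) conclusion VERBATIM at the class `U_k({Ω_j(Z)}, εr)`.  Proof: `…_threshold_residual_uniform` at `δc := T(ρn, εr)`, the (σ, (δ)) row per base field from `exists_gaugeLetterLoc_atRecord_explicit`
at `ν⟨εreg := εr⟩`, `W := ext V_k`.
[cite: Balaban1989LargeFieldII, p.357, (1.12)–(1.13) p.359; Balaban1989LargeFieldI, (1.74) p.192, Prop. 1 p.194; Balaban1985Variational, (2)–(4) p.278, Thm 1 p.279, (16)–(18) p.280, Sect. C (44)–(48) p.285, (181) p.307; Balaban1985RegularSpaces, (1.7) p.77, (1.19) p.79; Balaban1985Averaging, Prop. 2 (52)–(53) p.26, (122)–(126) p.36; Balaban1988Convergent, (1.3) p.246, (2.2) p.255, (2.10)–(2.13) pp.256–257, (2.16) p.257] -/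
theorem hMin_atRecord_of_node00Letters_thm1AtBase_central_ofClass_datumLetters_uniform (ν : Node00.Stage7Numerics) (Kt : ℕ) (hd : 2 ≤ (F.P Kt).d) (Z : Set (Site (F.P Kt) 0)) (𝔹 : DetSet (F.P Kt)) (h𝔹Z : 𝔹 = Bj ν.M₁ Z k) (hkK : k + 1 ≤ (F.P Kt).m + (F.P Kt).K)
    (hM4 : 4 * (F.P Kt).L ≤ ν.M₁) (hdiv : side (F.P Kt).L ν.M₁ k ∣ (F.P Kt).sitesPerDir 0) (hZblk : B14.Eq22Determines.IsBlockUnion k Z)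
    {ρ'' : ℝ} (hsbU : ∀ W : GaugeField (F.P Kt) 0 SU2, ‖coeField W - 1‖ ≤ ρ'' → SmallBelow (Node00.avOfRecord F 2 Kt) k W)
    (hρ : 0 < ρ'')
    (hk0 : 0 < k)
    -- ONCE per height: the right-inverse letter of the real chart (dag-n12-w6's `hHB`, inhabited by `N12HsurjOfClass.exists_hsurjLetters`)
    {εH B : ℝ}
    (hHB : ∀ (Wd : MSField (F.P Kt) SU2) (U₀ : GaugeField (F.P Kt) 0 SU2),
      AgreeOn (Bj ν.M₁ Z k) (avgFamily (avOfRecord F 2 Kt) U₀) Wd →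
      (∀ i' : Fin (constrCard (Bj ν.M₁ Z k) k), ∃ U' : GaugeField (F.P Kt) 0 SU2,
        (∀ b ∈ feeds (((constrEnum (Bj ν.M₁ Z k) k).symm i').1 : ℕ) ((constrEnum (Bj ν.M₁ Z k) k).symm i').2.1, U' b = U₀ b) ∧
          SmallBelow (avOfRecord F 2 Kt) k U') →
      (∀ (j : ℕ), 1 ≤ j → j ≤ k → ∀ y : Site (F.P Kt) j, embIter j y ∈ maxDomT ν.M₁ Z j → ∃ U' : GaugeField (F.P Kt) 0 SU2,
        (∀ c : PBond (F.P Kt) j, (c.src = y ∨ c.tgt = y) → ∀ b₀ : PBond (F.P Kt) 0,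
          (iterBlockOf j b₀.src = c.src ∨ iterBlockOf j b₀.src = c.tgt) → (iterBlockOf j b₀.tgt = c.src ∨ iterBlockOf j b₀.tgt = c.tgt) → U' b₀ = U₀ b₀) ∧
        SmallBelow (avOfRecord F 2 Kt) k U') →
      (∀ (j : ℕ), 1 ≤ j → j ≤ k → ∀ y : Site (F.P Kt) j, embIter j y ∈ maxDomT ν.M₁ Z j →
        PlaqSmallOn (boxPlaqs (fun κ => lift (F.P Kt) (embIter j y) κ - ((((F.P Kt).L ^ j : ℕ) : ℤ) + ((((F.P Kt).L ^ j - 1) / 2 : ℕ) : ℤ)))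
          (fun κ => lift (F.P Kt) (embIter j y) κ + ((((F.P Kt).L ^ j : ℕ) : ℤ) + ((((F.P Kt).L ^ j - 1) / 2 : ℕ) : ℤ))) : Set (Plaq (F.P Kt) 0)) εH U₀) →
      ∃ H : (Fin (constrCard (Bj ν.M₁ Z k) k) → lieSU (Fin 2)) → PBond (F.P Kt) 0 → lieSU (Fin 2),
        (∀ v, fderiv ℝ (msChart F 2 Kt k (Bj ν.M₁ Z k) Wd U₀) 0 (H v) = v) ∧ ∀ v, Real.sqrt (∑ b, ‖H v b‖ ^ 2) ≤ B * ‖v‖) (hB0 : 0 ≤ B)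
    -- ONE forest and its axial slice per instance (dag-n12-w3's `N12ForestSlice.exists_forest_slice_Bj`): (F1), (F2), (TREE), (F3)
    (path : Site (F.P Kt) 0 → List (LStep (F.P Kt) 0)) (S : Submodule ℂ (VecField (F.P Kt) 0 (EuclideanSpace ℂ (Fin 3))))
    (hF1 : ∀ x, ∀ s ∈ path x, ∃ x' x'' : Site (F.P Kt) 0, path x'' = path x' ++ [s] ∧
        (s.fwd = true → s.bond.src = x' ∧ s.bond.tgt = x'') ∧ (s.fwd = false → s.bond.src = x'' ∧ s.bond.tgt = x'))
    (hF2 : ∀ j, j ≤ k → ∀ c ∈ bondsOf (𝔹 j), path (embIter j c.src) = [] ∧ path (embIter j c.tgt) = [])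
    (hTREE : ∀ x : Site (F.P Kt) 0, x ∉ {z : Site (F.P Kt) 0 | ∃ j, j ≤ k ∧ ∃ c ∈ bondsOf (𝔹 j), (z = embIter j c.src ∨ z = embIter j c.tgt)} →
      ∃ (x' : Site (F.P Kt) 0) (s : LStep (F.P Kt) 0), path x = path x' ++ [s] ∧
        (s.fwd = true → s.bond.src = x' ∧ s.bond.tgt = x) ∧ (s.fwd = false → s.bond.src = x ∧ s.bond.tgt = x'))
    (hF3 : ∀ X : VecField (F.P Kt) 0 (EuclideanSpace ℂ (Fin 3)), X ∈ S ↔ ∀ x, ∀ s ∈ path x, X s.bond = 0)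
    -- (σ)_N OF RECORD (dag-n12-w3's `N12GaugeLetterLocExplicit.exists_gaugeLetterLoc_atRecord_explicit`), instance-level letters VERBATIM:
    -- NUMERICS (i): a level guard `k + c ≤ m + K` with `4d + m′ + 3 < 2·L^c` (no wrapping), and `M₁ ≥ (4d + m′)·L² + 2d·L + 12` (radii), `m′ = 3·(d·((L−1)∕2)) + 5`
    {c : ℕ} (hkc : k + c ≤ (F.P Kt).m + (F.P Kt).K) (hc : 4 * (F.P Kt).d + (3 * ((F.P Kt).d * (((F.P Kt).L - 1) / 2)) + 5) + 3 < 2 * (F.P Kt).L ^ c)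
    (hMrad : (4 * (F.P Kt).d + (3 * ((F.P Kt).d * (((F.P Kt).L - 1) / 2)) + 5)) * (F.P Kt).L ^ 2 + 2 * (F.P Kt).d * (F.P Kt).L + 12 ≤ ν.M₁)
    -- region geometry (dag-n12-w6's letters, verbatim) for a set `𝒞` of scale-`k` bonds and a fine bond set `N`
    (𝒞 : Set (PBond (F.P Kt) k))
    (N : Set (PBond (F.P Kt) 0))
    (hGN : ∀ b ∈ N, (b.src ∉ maxDomT ν.M₁ Z 1 ∨ b.tgt ∉ maxDomT ν.M₁ Z 1) → blockIter k b.tgt ≠ blockIter k b.src →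
      (⟨blockIter k b.src, b.dir⟩ : PBond (F.P Kt) k) ∈ 𝒞)
    (hN1 : ∀ p : Plaq (F.P Kt) 0, ((⟨p.src, p.μ⟩ : PBond (F.P Kt) 0) ∈ {b : PBond (F.P Kt) 0 | b.src ∈ maxDomT ν.M₁ Z 1} ∨
        (⟨p.src.shift p.μ, p.ν⟩ : PBond (F.P Kt) 0) ∈ {b : PBond (F.P Kt) 0 | b.src ∈ maxDomT ν.M₁ Z 1} ∨
        (⟨p.src.shift p.ν, p.μ⟩ : PBond (F.P Kt) 0) ∈ {b : PBond (F.P Kt) 0 | b.src ∈ maxDomT ν.M₁ Z 1} ∨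
        (⟨p.src, p.ν⟩ : PBond (F.P Kt) 0) ∈ {b : PBond (F.P Kt) 0 | b.src ∈ maxDomT ν.M₁ Z 1}) →
      (⟨p.src, p.μ⟩ : PBond (F.P Kt) 0) ∈ N ∧ (⟨p.src.shift p.μ, p.ν⟩ : PBond (F.P Kt) 0) ∈ N ∧
        (⟨p.src.shift p.ν, p.μ⟩ : PBond (F.P Kt) 0) ∈ N ∧ (⟨p.src, p.ν⟩ : PBond (F.P Kt) 0) ∈ N)
    -- the family's support numerics: `M₁ ≥ ((d+4)L + 6)·L²`
    (hM₁ : (((F.P Kt).d + 4) * (F.P Kt).L + 6) * (F.P Kt).L ^ 2 ≤ ν.M₁)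
    -- GEOMETRY instead of the datum letter: the `k`-shadows of the face-crossing members of `𝐁_k(Z)` lie in `𝒞`
    (hGmem : ∀ i ≤ k, ∀ c ∈ bondsOf ((Bj ν.M₁ Z k : DetSet (F.P Kt)) i), blockIter k (embIter i c.tgt) ≠ blockIter k (embIter i c.src) →
      (⟨blockIter k (embIter i c.src), c.dir⟩ : PBond (F.P Kt) k) ∈ 𝒞) :
    -- THE GAUGE-TOLERANCE THRESHOLD `δ₀`, announced before the base fields; the (σ)_N tolerance of record must sit below it
    ∃ δ₀ : ℝ, 0 < δ₀ ∧
    -- THE WINDOW, THE DATUM's REGULARITY TOLERANCE, THE EXTENSION, THE COMPACT PARAMETER SET AND THE BOUND — ALL AFTER THE CONSTANTS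
    ∀ (Λ : Set (Site (F.P Kt) k)) (lo hi : Fin (F.P Kt).d → ℤ) {δ : ℝ}, 0 < δ → 6 * ((((F.P Kt).d - 1 : ℕ)) : ℝ) * (F.P Kt).L ^ k * δ ≤ ρ'' →
    ∀ (ext : GaugeField (F.P Kt) k SU2 → GaugeField (F.P Kt) k SU2), (∀ W, ext W = extend Λ (shellGauge W lo hi) W) →
    ∀ {K : Set (GaugeField (F.P Kt) k SU2)}, IsCompact K → ∀ {𝓐₀ : ℝ}, 1 < 𝓐₀ →
    -- THE CLASS TOLERANCE (positive, [4]-Prop.-2-small, below the floors), THE CLASS FACTS, THE DATUM TOLERANCE — ALL AFTER THE THRESHOLD (`ν⟨εreg := εr⟩`, `M₁` unchanged)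
    ∀ (εr : ℝ), 0 < εr → 12 * ((((F.P Kt).d - 1 : ℕ)) : ℝ) * (F.P Kt).L * εr ≤ ρ'' → εr ≤ εH →
    (143 * (((((F.P Kt).d + 4 : ℕ) : ℝ)) ^ 2 / 4) ^ 2) * (εr * (F.P Kt).L ^ 2) ≤ 1 / 3 →
    2 * (εr * (F.P Kt).L ^ 2) ≤ 2 * deltaSU (Fin 2) / ((((F.P Kt).d + 4) * (F.P Kt).L : ℕ) : ℝ) ^ 2 →
    (((((F.P Kt).d + 2) * (F.P Kt).L : ℕ) : ℝ) ^ 2 / 4) * (2 * (εr * (F.P Kt).L ^ 2)) < deltaSU (Fin 2) →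
    ∀ (reg' : Set (GaugeField (F.P Kt) 0 SU2)), IsClosed reg' → closure (Node00.regMSCoPOfRecord F 2 {ν with εreg := εr} Kt k (maxDomT ν.M₁ Z)) ⊆ reg' →
      ContinuousOn (fun (U : GaugeField (F.P Kt) 0 SU2) (i : Fin (constrCard 𝔹 k)) =>
        ((avgFamily (Node00.avOfRecord F 2 Kt) U ((constrEnum 𝔹 k).symm i).1 ((constrEnum 𝔹 k).symm i).2.1 : SU2) : Matrix (Fin 2) (Fin 2) ℂ)) reg' →
    ∀ {ρn : ℝ}, 0 ≤ ρn →
    ((max ρn ((((2 * (∑ i ∈ Finset.range (k + 1), ((F.P Kt).d * (((F.P Kt).L ^ i - 1) / 2) + 1)) + 1 +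
                  (3 * ((F.P Kt).d * (((F.P Kt).L - 1) / 2)) + 5) * (F.P Kt).L ^ k : ℕ) : ℝ)) ^ 2 / 4 * (εr * (F.P Kt).eta 0 ^ 2) +
                ((3 * ((F.P Kt).d * (((F.P Kt).L - 1) / 2)) + 5 : ℕ) : ℝ) * (6 * ((((((F.P Kt).d + 2) * (F.P Kt).L : ℕ) : ℝ) ^ 2 / 4) * (2 * (εr * (F.P Kt).L ^ 2))) * ∑ i ∈ Finset.range k, ((F.P Kt).L : ℝ) ^ i) + ((3 * ((F.P Kt).d * (((F.P Kt).L - 1) / 2)) + 5 : ℕ) : ℝ) * ρn) ≤ δ₀) →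
    (∀ Vk ∈ K, ∃ U₀ : GaugeField (F.P Kt) 0 SU2,
      IsMinimizer (Node00.avOfRecord F 2 Kt) (Node00.regMSCoPOfRecord F 2 {ν with εreg := εr} Kt k (maxDomT ν.M₁ Z)) 𝔹
        (avgFamily (Node00.avOfRecord F 2 Kt) (qsstarGIter0 k (ext Vk))) U₀ ∧
      PlaqSmallOn (plaqsInside (pts k Z)) δ (ext Vk) ∧
      -- THE DATUM LETTER (region-normalised datum): `ext V_k` is `ρn`-flat on `𝒞`
      (∀ c ∈ 𝒞, dist1 ((ext Vk) c) ≤ ρn) ∧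
      -- (T1@q₀) — the capstone's row verbatim
      (∀ U ∈ reg', AgreeOn 𝔹 (avgFamily (Node00.avOfRecord F 2 Kt) U) (avgFamily (Node00.avOfRecord F 2 Kt) (qsstarGIter0 k (ext Vk))) →
        wilsonAction4 U ≤ wilsonAction4 U₀ →
          ∃ u : GaugeTransf (F.P Kt) 0 SU2, (∀ j, j ≤ k → ∀ b ∈ bondsOf (𝔹 j), toMS u j b.src = toMS u j b.tgt ∧ ∀ g : SU2, toMS u j b.src * g = g * toMS u j b.src) ∧ gaugeAct u U = U₀)) →
    ∃ R : ℝ, 0 < R ∧ ∀ Vk ∈ K,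
      ∃ Ũ : VecField (F.P Kt) k (EuclideanSpace ℂ (Fin 3)) × VecField (F.P Kt) k (EuclideanSpace ℂ (Fin 3)) → PBond (F.P Kt) 0 → Matrix (Fin 2) (Fin 2) ℂ,
        (∀ b i j, DifferentiableOn ℂ (fun z => Ũ z b i j) (ball 0 R)) ∧
        (∀ z ∈ ball (0 : VecField (F.P Kt) k (EuclideanSpace ℂ (Fin 3)) × VecField (F.P Kt) k (EuclideanSpace ℂ (Fin 3))) R, ∀ b i j, ‖Ũ z b i j‖ ≤ 𝓐₀) ∧
        ∀ p B' : VecField (F.P Kt) k E3, ‖p‖ < R → ‖B'‖ < R → ∃ U' : GaugeField (F.P Kt) 0 SU2,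
          (∀ b, Ũ (cplxVec p, cplxVec B') b = ((U' b : SU2) : Matrix (Fin 2) (Fin 2) ℂ)) ∧
            IsMinimizer (Node00.avOfRecord F 2 Kt) (Node00.regMSCoPOfRecord F 2 {ν with εreg := εr} Kt k (maxDomT ν.M₁ Z)) 𝔹
              (avgFamily (Node00.avOfRecord F 2 Kt) (qsstarGIter0 k (expMul su2Chart B' (ext (expMul su2Chart p Vk))))) U')
:= by
  obtain ⟨δ₀, hδ₀, h⟩ := hMin_atRecord_of_node00Letters_thm1AtBase_central_ofClass_threshold_residual_uniform ν Kt hd Z 𝔹 h𝔹Z hkK hM4 hdiv hZblk hsbU hρ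
    hk0 hHB hB0 path S hF1 hF2 hTREE hF3
  refine ⟨δ₀, hδ₀, fun Λ lo hi {δ} hδ hδρ ext hext {K} hK {𝓐₀} h𝓐₀ εr hεpos hερ hεH hα3 hα2 haN reg' hreg' hcl hDreg' {ρn} hρn hT hbase =>
    h Λ lo hi hδ hδρ ext hext hK h𝓐₀ εr hεpos.le hερ hεH reg' hreg' hcl hDreg' ?_ hT fun Vk hVk => ?_⟩
  · exact le_trans hρn (le_max_left _ _)
  obtain ⟨U₀, hmin, hreg, hD, hT1⟩ := hbase Vk hVk
  subst h𝔹Z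
  have hk : k ≤ (F.P Kt).m + (F.P Kt).K := Nat.le_of_succ_le hkK
  obtain ⟨σ, hσ, hNF, -⟩ := exists_gaugeLetterLoc_atRecord_explicit {ν with εreg := εr} Kt hk0 hk hdiv Z hkc hc hMrad hρn (ext Vk) 𝒞 hD hmin N hGN hN1
    hεpos hα3 hα2 haN hM₁ hGmem
  exact ⟨U₀, σ, hmin, hreg, hσ, hNF, hT1⟩

end Summit.QuantumFields.YangMills.BalabanUVNodes.N12MinimiserFamilyOfClassDatumLettersUniform

end
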